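import Literature.Analysis.Fourier.HilbertTransformLineInvPowSpan
import HarnessLib

/-!
# The Schochet–ALSS two-pole solution of the viscous CLM on `ℝ` (NS-type line, `a = 0`): the profile, its genuine
# Hilbert transform, and the exact PDE residual identity

HONEST FRAMING (cell ns-blowup GROUP B «PROFILE SEARCH», zone Z3, rows Z3-E12⁻ / Z3-U of `HOME/profile/z3/CENSUS-Z3.md`;
human rulings D-0035/D-0074): **1-D MODEL (the viscous Constantin–Lax–Majda equation `ω_t = ω·Hω + ν ω_xx` on `ℝ`, i.e. the
gCLM/OSW model at `a = 0` with constant viscosity); not Euler, not Navier–Stokes; «violates: none — MODEL».**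

OBJECT. Schochet's explicit pole-dynamics solution [Schochet 1986, Comm. Pure Appl. Math. 39], in the corrected form of
[cite: AmbroseLushnikovSiegelSilantyev2024, §5.1 (eqs. for `A, B, C, D, x₁, x₂`, `K_± = 24(3 ± √6)`, `t_c`)], specialised to the
odd configuration (both poles on the negative imaginary axis, depths `0 < y₁ < y₂`, `y₂ = y₁ + s`): with `u_k(L; ξ) = (L − iξ)^{−k}`
(the Cayley functions of `Literature.Analysis.Fourier.HilbertTransformLineInvPow`) the vorticity is the REAL combination

  `ω = a·(Im u₁(y₁) − Im u₁(y₂)) + b·(Im u₂(y₁) + Im u₂(y₂))`,  `a = −24kν/s`, `b = −12ν`, `k² − 6k + 3 = 0` (`k = K_±/24`),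

i.e. `ω(ξ) = a(ξ/(ξ²+y₁²) − ξ/(ξ²+y₂²)) + b(2y₁ξ/(ξ²+y₁²)² + 2y₂ξ/(ξ²+y₂²)²)`, and the pole depths move by `ẏ₁ = −10kν/s`,
`ẏ₂ = +10kν/s` (so `ṡ = 20kν/s`, `ȧ = 480k²ν²/s³`). This file proves the x-level facts that the blow-up theorem
(`SheetNSLineSchochetTwoPoleBlowup.lean`) assembles:
* `hilbertTransform_twoPole` — with the GENUINE line Hilbert transform `H = hilbertTransform` (convention `H cos = sin`,
  `HilbertTransformLine.lean`): `Hω = −a(Re u₁(y₁) − Re u₁(y₂)) − b(Re u₂(y₁) + Re u₂(y₂))` in closed real form, from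
  `hilbertTransform_cayleyInvPow` (`H(Im u_k) = −Re u_k`) and additivity on the Cayley span (`hilbertTransform_reIm_twoPole`);
* `hasDerivAt_twoPole_x`, `hasDerivAt_twoPole_xx` — the first two `x`-derivatives in closed form (building blocks
  `hasDerivAt_f`, `hasDerivAt_fx`, `hasDerivAt_g`, `hasDerivAt_gx`), and the pole-depth derivatives `hasDerivAt_f_depth`,
  `hasDerivAt_g_depth` used by the chain rule in time;
* `residual_identity` — the EXACT algebraic identity `ω_t − ω·Hω − ν·ω_xx = (k² − 6k + 3)·R` with an explicit rational `R`
  (pure `field_simp; ring`), where `ω_t` is the chain-rule time derivative along the pole motion: the viscous CLM holds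
  identically exactly when `k² − 6k + 3 = 0` (`k = 3 ± √6`, ALSS's corrected `K_± = 24k`).
WHAT IS NOT HERE: the time parametrisation, blow-up and small-data read-outs (next file); uniqueness of classical solutions;
anything about Navier–Stokes. No definitions, no named facts. bears_on: LADDER-NS N5 / zone Z3 → N1 linear core.
-/

noncomputable section

namespace Summit.NavierStokesRegularity.OSWSelfSimilar
namespace SheetNSLineSchochetTwoPole

open _root_.MeasureTheory Set Filter Complex Literature.Analysis.Fourier
open scoped Real Topology

/-! ### Closed real forms of `u₁ = (L − iξ)^{-1}` and `u₂ = (L − iξ)^{-2}` -/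

/-- `|L − iξ|² = L² + ξ²`. [folklore] -/
private theorem normSq_cayley (L ξ : ℝ) : Complex.normSq ((L : ℂ) - I * ξ) = L ^ 2 + ξ ^ 2 := by
  simp [Complex.normSq_apply]
  ring

/-- `Re (L − iξ)^{-1} = L/(L² + ξ²)`. [folklore] -/
theorem cayleyOne_re (L ξ : ℝ) : ((((L : ℂ) - I * ξ) ^ 1)⁻¹).re = L / (L ^ 2 + ξ ^ 2) := by
  rw [pow_one, Complex.inv_re, normSq_cayley]
  simp

/-- `Im (L − iξ)^{-1} = ξ/(L² + ξ²)`. [folklore] -/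
theorem cayleyOne_im (L ξ : ℝ) : ((((L : ℂ) - I * ξ) ^ 1)⁻¹).im = ξ / (L ^ 2 + ξ ^ 2) := by
  rw [pow_one, Complex.inv_im, normSq_cayley]
  simp

/-- `Re (L − iξ)^{-2} = (L² − ξ²)/(L² + ξ²)²`. [folklore] -/
theorem cayleyTwo_re (L ξ : ℝ) : ((((L : ℂ) - I * ξ) ^ 2)⁻¹).re = (L ^ 2 - ξ ^ 2) / (L ^ 2 + ξ ^ 2) ^ 2 := by
  rw [Complex.inv_re, map_pow, normSq_cayley]
  simp [sq, Complex.mul_re]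

/-- `Im (L − iξ)^{-2} = 2Lξ/(L² + ξ²)²`. [folklore] -/
theorem cayleyTwo_im (L ξ : ℝ) : ((((L : ℂ) - I * ξ) ^ 2)⁻¹).im = 2 * L * ξ / (L ^ 2 + ξ ^ 2) ^ 2 := by
  rw [Complex.inv_im, map_pow, normSq_cayley]
  simp [sq, Complex.mul_im]
  ring

/-! ### Integrability of the symmetric p.v. integrands (hypotheses of `hilbertTransform_add`) -/

/-- `(L² + ξ²)⁻¹ ∈ L¹(ℝ)` for `L > 0`. [folklore] -/
private theorem integrable_inv_sq_add_sq {L : ℝ} (hL : 0 < L) : Integrable fun ξ : ℝ => (L ^ 2 + ξ ^ 2)⁻¹ := by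
  have h := (integrable_inv_one_add_sq.comp_div hL.ne').const_mul (L ^ 2)⁻¹
  refine h.congr (Eventually.of_forall fun ξ => ?_)
  have hL2 : L ^ 2 ≠ 0 := by positivity
  simp only
  field_simp

/-- `(L² + ξ²)⁻¹` is `C¹`. [folklore] -/
private theorem contDiff_inv_sq_add_sq {L : ℝ} (hL : 0 < L) : ContDiff ℝ 1 fun ξ : ℝ => (L ^ 2 + ξ ^ 2)⁻¹ := by
  refine ContDiff.inv (by fun_prop) fun ξ => ?_
  positivity

/-- Symmetric integrand of a constant multiple. [folklore] -/
private theorem symm_const_mul (f : ℝ → ℝ) {x : ℝ} (c : ℝ)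
    (hf : IntegrableOn (fun t => (f (x - t) - f (x + t)) / t) (Ioi 0)) :
    IntegrableOn (fun t => (c * f (x - t) - c * f (x + t)) / t) (Ioi 0) := by
  refine IntegrableOn.congr_fun (hf.const_mul c) (fun t _ => ?_) measurableSet_Ioi
  ring

/-- Symmetric integrand of a sum. [folklore] -/
private theorem symm_add (f g : ℝ → ℝ) {x : ℝ}
    (hf : IntegrableOn (fun t => (f (x - t) - f (x + t)) / t) (Ioi 0))
    (hg : IntegrableOn (fun t => (g (x - t) - g (x + t)) / t) (Ioi 0)) :
    IntegrableOn (fun t => ((f (x - t) + g (x - t)) - (f (x + t) + g (x + t))) / t) (Ioi 0) := by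
  refine IntegrableOn.congr_fun (hf.add hg) (fun t _ => ?_) measurableSet_Ioi
  simp only [Pi.add_apply]
  ring

/-- Symmetric integrand of `y ↦ y·f(y)` from that of an integrable `f` (derivation of the moment formula).
[cite: King2009HilbertTransforms2, eq. (19.150) (moment formula, its derivation)] -/
private theorem symm_id_mul (f : ℝ → ℝ) {x : ℝ} (hf : Integrable f)
    (hint : IntegrableOn (fun t => (f (x - t) - f (x + t)) / t) (Ioi 0)) :
    IntegrableOn (fun t => ((x - t) * f (x - t) - (x + t) * f (x + t)) / t) (Ioi 0) := by
  have hA : Integrable (fun t => f (x - t)) := hf.comp_sub_left x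
  have hB : Integrable (fun t => f (x + t)) := hf.comp_add_left x
  have h : IntegrableOn (fun t => x * ((f (x - t) - f (x + t)) / t) - (f (x - t) + f (x + t))) (Ioi 0) :=
    (hint.const_mul x).sub (hA.add hB).integrableOn
  refine IntegrableOn.congr_fun h (fun t ht => ?_) measurableSet_Ioi
  have ht0 : t ≠ 0 := ne_of_gt ht
  field_simp
  ring

/-- Symmetric integrand of `Re u₁ = L/(L²+ξ²)` (`C¹ ∩ L¹`). [folklore] -/
private theorem symm_re_one {L : ℝ} (hL : 0 < L) (x : ℝ) :
    IntegrableOn (fun t : ℝ => (((((L : ℂ) - I * ((x - t : ℝ) : ℂ)) ^ 1)⁻¹).re - ((((L : ℂ) - I * ((x + t : ℝ) : ℂ)) ^ 1)⁻¹).re) / t)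
      (Ioi 0) := by
  have h := symm_const_mul (fun ξ : ℝ => (L ^ 2 + ξ ^ 2)⁻¹) L
    (integrableOn_symmIntegrand_of_contDiff (contDiff_inv_sq_add_sq hL) (integrable_inv_sq_add_sq hL) x)
  refine IntegrableOn.congr_fun h (fun t _ => ?_) measurableSet_Ioi
  simp only [cayleyOne_re, div_eq_mul_inv]

/-- Symmetric integrand of `Im u₁ = ξ/(L²+ξ²)` (moment of an integrable `C¹` function). [folklore] -/
private theorem symm_im_one {L : ℝ} (hL : 0 < L) (x : ℝ) :
    IntegrableOn (fun t : ℝ => (((((L : ℂ) - I * ((x - t : ℝ) : ℂ)) ^ 1)⁻¹).im - ((((L : ℂ) - I * ((x + t : ℝ) : ℂ)) ^ 1)⁻¹).im) / t)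
      (Ioi 0) := by
  have h := symm_id_mul (fun ξ : ℝ => (L ^ 2 + ξ ^ 2)⁻¹) (integrable_inv_sq_add_sq hL)
    (integrableOn_symmIntegrand_of_contDiff (contDiff_inv_sq_add_sq hL) (integrable_inv_sq_add_sq hL) x)
  refine IntegrableOn.congr_fun h (fun t _ => ?_) measurableSet_Ioi
  simp only [cayleyOne_im, div_eq_mul_inv]

/-- Symmetric integrand of `Re u₂` (`C¹ ∩ L¹`). [folklore] -/
private theorem symm_re_two {L : ℝ} (hL : 0 < L) (x : ℝ) :
    IntegrableOn (fun t : ℝ => (((((L : ℂ) - I * ((x - t : ℝ) : ℂ)) ^ 2)⁻¹).re - ((((L : ℂ) - I * ((x + t : ℝ) : ℂ)) ^ 2)⁻¹).re) / t)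
      (Ioi 0) :=
  integrableOn_symmIntegrand_of_contDiff (f := fun ξ : ℝ => ((((L : ℂ) - I * ξ) ^ 2)⁻¹).re)
    (Complex.reCLM.contDiff.comp (contDiff_cayleyInvPow hL 2)) (integrable_cayleyInvPow hL le_rfl).re x

/-- Symmetric integrand of `Im u₂` (`C¹ ∩ L¹`). [folklore] -/
private theorem symm_im_two {L : ℝ} (hL : 0 < L) (x : ℝ) :
    IntegrableOn (fun t : ℝ => (((((L : ℂ) - I * ((x - t : ℝ) : ℂ)) ^ 2)⁻¹).im - ((((L : ℂ) - I * ((x + t : ℝ) : ℂ)) ^ 2)⁻¹).im) / t)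
      (Ioi 0) :=
  integrableOn_symmIntegrand_of_contDiff (f := fun ξ : ℝ => ((((L : ℂ) - I * ξ) ^ 2)⁻¹).im)
    (Complex.imCLM.contDiff.comp (contDiff_cayleyInvPow hL 2)) (integrable_cayleyInvPow hL le_rfl).im x

/-! ### The Hilbert transform of the two-pole profile -/

/-- The pair identity `H(Re G) = Im G`, `H(Im G) = −Re G` for the four-term Cayley combination
`G = a·u₁(y₁) − a·u₁(y₂) + b·u₂(y₁) + b·u₂(y₂)` (`y₁, y₂ > 0`, `a, b ∈ ℝ`).
[cite: King2009HilbertTransforms2, Appendix 1, Table 1.2 entries (2.2), (2.4), (2.5) with Table 1.1 (1.3), (1.21)] -/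
theorem hilbertTransform_reIm_twoPole {y₁ y₂ : ℝ} (hy₁ : 0 < y₁) (hy₂ : 0 < y₂) (a b x : ℝ) :
    hilbertTransform (fun ξ : ℝ => ((a : ℂ) * (((y₁ : ℂ) - I * ξ) ^ 1)⁻¹ + (-a : ℝ) * (((y₂ : ℂ) - I * ξ) ^ 1)⁻¹
        + (b : ℂ) * (((y₁ : ℂ) - I * ξ) ^ 2)⁻¹ + (b : ℂ) * (((y₂ : ℂ) - I * ξ) ^ 2)⁻¹).re) x
      = ((a : ℂ) * (((y₁ : ℂ) - I * x) ^ 1)⁻¹ + (-a : ℝ) * (((y₂ : ℂ) - I * x) ^ 1)⁻¹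
        + (b : ℂ) * (((y₁ : ℂ) - I * x) ^ 2)⁻¹ + (b : ℂ) * (((y₂ : ℂ) - I * x) ^ 2)⁻¹).im ∧
    hilbertTransform (fun ξ : ℝ => ((a : ℂ) * (((y₁ : ℂ) - I * ξ) ^ 1)⁻¹ + (-a : ℝ) * (((y₂ : ℂ) - I * ξ) ^ 1)⁻¹
        + (b : ℂ) * (((y₁ : ℂ) - I * ξ) ^ 2)⁻¹ + (b : ℂ) * (((y₂ : ℂ) - I * ξ) ^ 2)⁻¹).im) x
      = -((a : ℂ) * (((y₁ : ℂ) - I * x) ^ 1)⁻¹ + (-a : ℝ) * (((y₂ : ℂ) - I * x) ^ 1)⁻¹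
        + (b : ℂ) * (((y₁ : ℂ) - I * x) ^ 2)⁻¹ + (b : ℂ) * (((y₂ : ℂ) - I * x) ^ 2)⁻¹).re := by
  -- the four scaled terms and their pair identities
  have P1 := hilbertTransform_reIm_ofReal_mul a (hilbertTransform_cayleyInvPow hy₁ (le_refl 1) x)
  have P2 := hilbertTransform_reIm_ofReal_mul (-a) (hilbertTransform_cayleyInvPow hy₂ (le_refl 1) x)
  have P3 := hilbertTransform_reIm_ofReal_mul b (hilbertTransform_cayleyInvPow hy₁ (by norm_num : 1 ≤ 2) x)
  have P4 := hilbertTransform_reIm_ofReal_mul b (hilbertTransform_cayleyInvPow hy₂ (by norm_num : 1 ≤ 2) x)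
  -- symmetric integrability of the re/im parts of the scaled terms
  have S1r : IntegrableOn (fun t : ℝ => (((a : ℂ) * (((y₁ : ℂ) - I * ((x - t : ℝ) : ℂ)) ^ 1)⁻¹).re
      - ((a : ℂ) * (((y₁ : ℂ) - I * ((x + t : ℝ) : ℂ)) ^ 1)⁻¹).re) / t) (Ioi 0) := by
    simpa only [Complex.re_ofReal_mul] using symm_const_mul (fun ξ : ℝ => ((((y₁ : ℂ) - I * ξ) ^ 1)⁻¹).re) a (symm_re_one hy₁ x)
  have S1i : IntegrableOn (fun t : ℝ => (((a : ℂ) * (((y₁ : ℂ) - I * ((x - t : ℝ) : ℂ)) ^ 1)⁻¹).im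
      - ((a : ℂ) * (((y₁ : ℂ) - I * ((x + t : ℝ) : ℂ)) ^ 1)⁻¹).im) / t) (Ioi 0) := by
    simpa only [Complex.im_ofReal_mul] using symm_const_mul (fun ξ : ℝ => ((((y₁ : ℂ) - I * ξ) ^ 1)⁻¹).im) a (symm_im_one hy₁ x)
  have S2r : IntegrableOn (fun t : ℝ => ((((-a : ℝ) : ℂ) * (((y₂ : ℂ) - I * ((x - t : ℝ) : ℂ)) ^ 1)⁻¹).re
      - (((-a : ℝ) : ℂ) * (((y₂ : ℂ) - I * ((x + t : ℝ) : ℂ)) ^ 1)⁻¹).re) / t) (Ioi 0) := by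
    simpa only [Complex.re_ofReal_mul] using symm_const_mul (fun ξ : ℝ => ((((y₂ : ℂ) - I * ξ) ^ 1)⁻¹).re) (-a) (symm_re_one hy₂ x)
  have S2i : IntegrableOn (fun t : ℝ => ((((-a : ℝ) : ℂ) * (((y₂ : ℂ) - I * ((x - t : ℝ) : ℂ)) ^ 1)⁻¹).im
      - (((-a : ℝ) : ℂ) * (((y₂ : ℂ) - I * ((x + t : ℝ) : ℂ)) ^ 1)⁻¹).im) / t) (Ioi 0) := by
    simpa only [Complex.im_ofReal_mul] using symm_const_mul (fun ξ : ℝ => ((((y₂ : ℂ) - I * ξ) ^ 1)⁻¹).im) (-a) (symm_im_one hy₂ x)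
  have S3r : IntegrableOn (fun t : ℝ => (((b : ℂ) * (((y₁ : ℂ) - I * ((x - t : ℝ) : ℂ)) ^ 2)⁻¹).re
      - ((b : ℂ) * (((y₁ : ℂ) - I * ((x + t : ℝ) : ℂ)) ^ 2)⁻¹).re) / t) (Ioi 0) := by
    simpa only [Complex.re_ofReal_mul] using symm_const_mul (fun ξ : ℝ => ((((y₁ : ℂ) - I * ξ) ^ 2)⁻¹).re) b (symm_re_two hy₁ x)
  have S3i : IntegrableOn (fun t : ℝ => (((b : ℂ) * (((y₁ : ℂ) - I * ((x - t : ℝ) : ℂ)) ^ 2)⁻¹).im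
      - ((b : ℂ) * (((y₁ : ℂ) - I * ((x + t : ℝ) : ℂ)) ^ 2)⁻¹).im) / t) (Ioi 0) := by
    simpa only [Complex.im_ofReal_mul] using symm_const_mul (fun ξ : ℝ => ((((y₁ : ℂ) - I * ξ) ^ 2)⁻¹).im) b (symm_im_two hy₁ x)
  have S4r : IntegrableOn (fun t : ℝ => (((b : ℂ) * (((y₂ : ℂ) - I * ((x - t : ℝ) : ℂ)) ^ 2)⁻¹).re
      - ((b : ℂ) * (((y₂ : ℂ) - I * ((x + t : ℝ) : ℂ)) ^ 2)⁻¹).re) / t) (Ioi 0) := by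
    simpa only [Complex.re_ofReal_mul] using symm_const_mul (fun ξ : ℝ => ((((y₂ : ℂ) - I * ξ) ^ 2)⁻¹).re) b (symm_re_two hy₂ x)
  have S4i : IntegrableOn (fun t : ℝ => (((b : ℂ) * (((y₂ : ℂ) - I * ((x - t : ℝ) : ℂ)) ^ 2)⁻¹).im
      - ((b : ℂ) * (((y₂ : ℂ) - I * ((x + t : ℝ) : ℂ)) ^ 2)⁻¹).im) / t) (Ioi 0) := by
    simpa only [Complex.im_ofReal_mul] using symm_const_mul (fun ξ : ℝ => ((((y₂ : ℂ) - I * ξ) ^ 2)⁻¹).im) b (symm_im_two hy₂ x)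
  -- add the terms one by one
  have Q2 := hilbertTransform_reIm_add (F := (fun ξ : ℝ => (a : ℂ) * (((y₁ : ℂ) - I * ξ) ^ 1)⁻¹))
    (G := (fun ξ : ℝ => ((-a : ℝ) : ℂ) * (((y₂ : ℂ) - I * ξ) ^ 1)⁻¹)) S1r S1i S2r S2i P1 P2
  have S12r : IntegrableOn (fun t : ℝ => (((a : ℂ) * (((y₁ : ℂ) - I * ((x - t : ℝ) : ℂ)) ^ 1)⁻¹
        + ((-a : ℝ) : ℂ) * (((y₂ : ℂ) - I * ((x - t : ℝ) : ℂ)) ^ 1)⁻¹).re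
      - ((a : ℂ) * (((y₁ : ℂ) - I * ((x + t : ℝ) : ℂ)) ^ 1)⁻¹ + ((-a : ℝ) : ℂ) * (((y₂ : ℂ) - I * ((x + t : ℝ) : ℂ)) ^ 1)⁻¹).re) / t)
      (Ioi 0) := by
    simpa only [Complex.add_re] using symm_add (fun ξ : ℝ => ((a : ℂ) * (((y₁ : ℂ) - I * ξ) ^ 1)⁻¹).re) (fun ξ : ℝ => (((-a : ℝ) : ℂ) * (((y₂ : ℂ) - I * ξ) ^ 1)⁻¹).re) S1r S2r
  have S12i : IntegrableOn (fun t : ℝ => (((a : ℂ) * (((y₁ : ℂ) - I * ((x - t : ℝ) : ℂ)) ^ 1)⁻¹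
        + ((-a : ℝ) : ℂ) * (((y₂ : ℂ) - I * ((x - t : ℝ) : ℂ)) ^ 1)⁻¹).im
      - ((a : ℂ) * (((y₁ : ℂ) - I * ((x + t : ℝ) : ℂ)) ^ 1)⁻¹ + ((-a : ℝ) : ℂ) * (((y₂ : ℂ) - I * ((x + t : ℝ) : ℂ)) ^ 1)⁻¹).im) / t)
      (Ioi 0) := by
    simpa only [Complex.add_im] using symm_add (fun ξ : ℝ => ((a : ℂ) * (((y₁ : ℂ) - I * ξ) ^ 1)⁻¹).im) (fun ξ : ℝ => (((-a : ℝ) : ℂ) * (((y₂ : ℂ) - I * ξ) ^ 1)⁻¹).im) S1i S2i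
  have Q3 := hilbertTransform_reIm_add (F := (fun ξ : ℝ => (a : ℂ) * (((y₁ : ℂ) - I * ξ) ^ 1)⁻¹ + ((-a : ℝ) : ℂ) * (((y₂ : ℂ) - I * ξ) ^ 1)⁻¹))
    (G := (fun ξ : ℝ => (b : ℂ) * (((y₁ : ℂ) - I * ξ) ^ 2)⁻¹)) S12r S12i S3r S3i Q2 P3
  have S123r : IntegrableOn (fun t : ℝ => (((a : ℂ) * (((y₁ : ℂ) - I * ((x - t : ℝ) : ℂ)) ^ 1)⁻¹
        + ((-a : ℝ) : ℂ) * (((y₂ : ℂ) - I * ((x - t : ℝ) : ℂ)) ^ 1)⁻¹ + (b : ℂ) * (((y₁ : ℂ) - I * ((x - t : ℝ) : ℂ)) ^ 2)⁻¹).re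
      - ((a : ℂ) * (((y₁ : ℂ) - I * ((x + t : ℝ) : ℂ)) ^ 1)⁻¹ + ((-a : ℝ) : ℂ) * (((y₂ : ℂ) - I * ((x + t : ℝ) : ℂ)) ^ 1)⁻¹
        + (b : ℂ) * (((y₁ : ℂ) - I * ((x + t : ℝ) : ℂ)) ^ 2)⁻¹).re) / t) (Ioi 0) := by
    simpa only [Complex.add_re] using symm_add (fun ξ : ℝ => ((a : ℂ) * (((y₁ : ℂ) - I * ξ) ^ 1)⁻¹ + ((-a : ℝ) : ℂ) * (((y₂ : ℂ) - I * ξ) ^ 1)⁻¹).re)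
      (fun ξ : ℝ => ((b : ℂ) * (((y₁ : ℂ) - I * ξ) ^ 2)⁻¹).re) S12r S3r
  have S123i : IntegrableOn (fun t : ℝ => (((a : ℂ) * (((y₁ : ℂ) - I * ((x - t : ℝ) : ℂ)) ^ 1)⁻¹
        + ((-a : ℝ) : ℂ) * (((y₂ : ℂ) - I * ((x - t : ℝ) : ℂ)) ^ 1)⁻¹ + (b : ℂ) * (((y₁ : ℂ) - I * ((x - t : ℝ) : ℂ)) ^ 2)⁻¹).im
      - ((a : ℂ) * (((y₁ : ℂ) - I * ((x + t : ℝ) : ℂ)) ^ 1)⁻¹ + ((-a : ℝ) : ℂ) * (((y₂ : ℂ) - I * ((x + t : ℝ) : ℂ)) ^ 1)⁻¹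
        + (b : ℂ) * (((y₁ : ℂ) - I * ((x + t : ℝ) : ℂ)) ^ 2)⁻¹).im) / t) (Ioi 0) := by
    simpa only [Complex.add_im] using symm_add (fun ξ : ℝ => ((a : ℂ) * (((y₁ : ℂ) - I * ξ) ^ 1)⁻¹ + ((-a : ℝ) : ℂ) * (((y₂ : ℂ) - I * ξ) ^ 1)⁻¹).im)
      (fun ξ : ℝ => ((b : ℂ) * (((y₁ : ℂ) - I * ξ) ^ 2)⁻¹).im) S12i S3i
  exact hilbertTransform_reIm_add (F := (fun ξ : ℝ => (a : ℂ) * (((y₁ : ℂ) - I * ξ) ^ 1)⁻¹ + ((-a : ℝ) : ℂ) * (((y₂ : ℂ) - I * ξ) ^ 1)⁻¹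
      + (b : ℂ) * (((y₁ : ℂ) - I * ξ) ^ 2)⁻¹))
    (G := (fun ξ : ℝ => (b : ℂ) * (((y₂ : ℂ) - I * ξ) ^ 2)⁻¹)) S123r S123i S4r S4i Q3 P4

/-- **The Hilbert transform of the two-pole profile, closed real form.** For `y₁, y₂ > 0` and real `a, b`,
`H[a(ξ/(ξ²+y₁²) − ξ/(ξ²+y₂²)) + b(2y₁ξ/(ξ²+y₁²)² + 2y₂ξ/(ξ²+y₂²)²)](x)
 = −a(y₁/(x²+y₁²) − y₂/(x²+y₂²)) − b((y₁²−x²)/(x²+y₁²)² + (y₂²−x²)/(x²+y₂²)²)` (`H = hilbertTransform`): the function is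
`Im G` and the value is `−Re G` for the Cayley combination `G` of `hilbertTransform_reIm_twoPole`.
[cite: AmbroseLushnikovSiegelSilantyev2024, §5.1 (upper-analytic pole ansatz: `H` acts as `−i` on `ω₊`)] -/
theorem hilbertTransform_twoPole {y₁ y₂ : ℝ} (hy₁ : 0 < y₁) (hy₂ : 0 < y₂) (a b x : ℝ) :
    hilbertTransform (fun ξ : ℝ => a * (ξ / (ξ ^ 2 + y₁ ^ 2) - ξ / (ξ ^ 2 + y₂ ^ 2))
        + b * (2 * y₁ * ξ / (ξ ^ 2 + y₁ ^ 2) ^ 2 + 2 * y₂ * ξ / (ξ ^ 2 + y₂ ^ 2) ^ 2)) x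
      = -(a * (y₁ / (x ^ 2 + y₁ ^ 2) - y₂ / (x ^ 2 + y₂ ^ 2)))
        - b * ((y₁ ^ 2 - x ^ 2) / (x ^ 2 + y₁ ^ 2) ^ 2 + (y₂ ^ 2 - x ^ 2) / (x ^ 2 + y₂ ^ 2) ^ 2) := by
  have h := (hilbertTransform_reIm_twoPole hy₁ hy₂ a b x).2
  have e : (fun ξ : ℝ => a * (ξ / (ξ ^ 2 + y₁ ^ 2) - ξ / (ξ ^ 2 + y₂ ^ 2))
        + b * (2 * y₁ * ξ / (ξ ^ 2 + y₁ ^ 2) ^ 2 + 2 * y₂ * ξ / (ξ ^ 2 + y₂ ^ 2) ^ 2))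
      = (fun ξ : ℝ => ((a : ℂ) * (((y₁ : ℂ) - I * ξ) ^ 1)⁻¹ + (-a : ℝ) * (((y₂ : ℂ) - I * ξ) ^ 1)⁻¹
        + (b : ℂ) * (((y₁ : ℂ) - I * ξ) ^ 2)⁻¹ + (b : ℂ) * (((y₂ : ℂ) - I * ξ) ^ 2)⁻¹).im) := by
    funext ξ
    simp only [Complex.add_im, Complex.im_ofReal_mul, cayleyOne_im, cayleyTwo_im]
    ring
  rw [e, h]
  simp only [Complex.add_re, Complex.re_ofReal_mul, cayleyOne_re, cayleyTwo_re]
  ring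


/-! ### The real building blocks `f = Im u₁ = ξ/(ξ²+L²)`, `g = Im u₂ = 2Lξ/(ξ²+L²)²` and their derivatives -/

/-- `x² + L² ≠ 0` for `L > 0`. [folklore] -/
private theorem sq_add_sq_ne {L : ℝ} (hL : 0 < L) (x : ℝ) : x ^ 2 + L ^ 2 ≠ 0 := by positivity

/-- `∂ₓ [x/(x²+L²)] = (L² − x²)/(x²+L²)²`. [folklore] -/
theorem hasDerivAt_f {L : ℝ} (hL : 0 < L) (x : ℝ) :
    HasDerivAt (fun x : ℝ => x / (x ^ 2 + L ^ 2)) ((L ^ 2 - x ^ 2) / (x ^ 2 + L ^ 2) ^ 2) x := by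
  have hD : HasDerivAt (fun x : ℝ => x ^ 2 + L ^ 2) (2 * x) x := by
    simpa using (hasDerivAt_pow 2 x).add_const (L ^ 2)
  refine ((hasDerivAt_id' x).div hD (sq_add_sq_ne hL x)).congr_deriv ?_
  have := sq_add_sq_ne hL x
  try simp only [Pi.pow_apply]
  field_simp
  ring

/-- `∂ₓ [(L² − x²)/(x²+L²)²] = 2x(x² − 3L²)/(x²+L²)³`. [folklore] -/
theorem hasDerivAt_fx {L : ℝ} (hL : 0 < L) (x : ℝ) :
    HasDerivAt (fun x : ℝ => (L ^ 2 - x ^ 2) / (x ^ 2 + L ^ 2) ^ 2)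
      (2 * x * (x ^ 2 - 3 * L ^ 2) / (x ^ 2 + L ^ 2) ^ 3) x := by
  have hD : HasDerivAt (fun x : ℝ => x ^ 2 + L ^ 2) (2 * x) x := by
    simpa using (hasDerivAt_pow 2 x).add_const (L ^ 2)
  have hN : HasDerivAt (fun x : ℝ => L ^ 2 - x ^ 2) (-(2 * x)) x := by
    simpa using (hasDerivAt_pow 2 x).const_sub (L ^ 2)
  refine (hN.div (hD.pow 2) (pow_ne_zero 2 (sq_add_sq_ne hL x))).congr_deriv ?_
  have := sq_add_sq_ne hL x
  try simp only [Pi.pow_apply]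
  field_simp
  ring

/-- `∂ₓ [2Lx/(x²+L²)²] = 2L(L² − 3x²)/(x²+L²)³`. [folklore] -/
theorem hasDerivAt_g {L : ℝ} (hL : 0 < L) (x : ℝ) :
    HasDerivAt (fun x : ℝ => 2 * L * x / (x ^ 2 + L ^ 2) ^ 2)
      (2 * L * (L ^ 2 - 3 * x ^ 2) / (x ^ 2 + L ^ 2) ^ 3) x := by
  have hD : HasDerivAt (fun x : ℝ => x ^ 2 + L ^ 2) (2 * x) x := by
    simpa using (hasDerivAt_pow 2 x).add_const (L ^ 2)
  have hN : HasDerivAt (fun x : ℝ => 2 * L * x) (2 * L) x := by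
    simpa using (hasDerivAt_id x).const_mul (2 * L)
  refine (hN.div (hD.pow 2) (pow_ne_zero 2 (sq_add_sq_ne hL x))).congr_deriv ?_
  have := sq_add_sq_ne hL x
  try simp only [Pi.pow_apply]
  field_simp
  ring

/-- `∂ₓ [2L(L² − 3x²)/(x²+L²)³] = 24Lx(x² − L²)/(x²+L²)⁴`. [folklore] -/
theorem hasDerivAt_gx {L : ℝ} (hL : 0 < L) (x : ℝ) :
    HasDerivAt (fun x : ℝ => 2 * L * (L ^ 2 - 3 * x ^ 2) / (x ^ 2 + L ^ 2) ^ 3)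
      (24 * L * x * (x ^ 2 - L ^ 2) / (x ^ 2 + L ^ 2) ^ 4) x := by
  have hD : HasDerivAt (fun x : ℝ => x ^ 2 + L ^ 2) (2 * x) x := by
    simpa using (hasDerivAt_pow 2 x).add_const (L ^ 2)
  have hN : HasDerivAt (fun x : ℝ => 2 * L * (L ^ 2 - 3 * x ^ 2)) (2 * L * (-(3 * (2 * x)))) x := by
    have := ((hasDerivAt_pow 2 x).const_mul 3).const_sub (L ^ 2)
    simpa using this.const_mul (2 * L)
  refine (hN.div (hD.pow 3) (pow_ne_zero 3 (sq_add_sq_ne hL x))).congr_deriv ?_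
  have := sq_add_sq_ne hL x
  try simp only [Pi.pow_apply]
  field_simp
  ring

/-- `∂_L [x/(x²+L²)] = −2Lx/(x²+L²)²` (the pole-depth derivative of `f` is `−g`). [folklore] -/
theorem hasDerivAt_f_depth {L : ℝ} (hL : 0 < L) (x : ℝ) :
    HasDerivAt (fun L : ℝ => x / (x ^ 2 + L ^ 2)) (-(2 * L * x / (x ^ 2 + L ^ 2) ^ 2)) L := by
  have hD : HasDerivAt (fun L : ℝ => x ^ 2 + L ^ 2) (2 * L) L := by
    simpa using (hasDerivAt_pow 2 L).const_add (x ^ 2)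
  refine ((hasDerivAt_const L x).div hD (sq_add_sq_ne hL x)).congr_deriv ?_
  have := sq_add_sq_ne hL x
  try simp only [Pi.pow_apply]
  field_simp
  ring

/-- `∂_L [2Lx/(x²+L²)²] = 2x(x² − 3L²)/(x²+L²)³`. [folklore] -/
theorem hasDerivAt_g_depth {L : ℝ} (hL : 0 < L) (x : ℝ) :
    HasDerivAt (fun L : ℝ => 2 * L * x / (x ^ 2 + L ^ 2) ^ 2)
      (2 * x * (x ^ 2 - 3 * L ^ 2) / (x ^ 2 + L ^ 2) ^ 3) L := by
  have hD : HasDerivAt (fun L : ℝ => x ^ 2 + L ^ 2) (2 * L) L := by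
    simpa using (hasDerivAt_pow 2 L).const_add (x ^ 2)
  have hN : HasDerivAt (fun L : ℝ => 2 * L * x) (2 * x) L := by
    simpa [mul_comm, mul_assoc, mul_left_comm] using (hasDerivAt_id L).const_mul (2 * x)
  refine (hN.div (hD.pow 2) (pow_ne_zero 2 (sq_add_sq_ne hL x))).congr_deriv ?_
  have := sq_add_sq_ne hL x
  try simp only [Pi.pow_apply]
  field_simp
  ring

/-! ### The two-pole profile: first and second `x`-derivatives -/

/-- `∂ₓ ω` for `ω = a(f(y₁) − f(y₂)) + b(g(y₁) + g(y₂))`. [folklore] -/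
theorem hasDerivAt_twoPole_x {y₁ y₂ : ℝ} (hy₁ : 0 < y₁) (hy₂ : 0 < y₂) (a b x : ℝ) :
    HasDerivAt (fun x : ℝ => a * (x / (x ^ 2 + y₁ ^ 2) - x / (x ^ 2 + y₂ ^ 2))
        + b * (2 * y₁ * x / (x ^ 2 + y₁ ^ 2) ^ 2 + 2 * y₂ * x / (x ^ 2 + y₂ ^ 2) ^ 2))
      (a * ((y₁ ^ 2 - x ^ 2) / (x ^ 2 + y₁ ^ 2) ^ 2 - (y₂ ^ 2 - x ^ 2) / (x ^ 2 + y₂ ^ 2) ^ 2)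
        + b * (2 * y₁ * (y₁ ^ 2 - 3 * x ^ 2) / (x ^ 2 + y₁ ^ 2) ^ 3
          + 2 * y₂ * (y₂ ^ 2 - 3 * x ^ 2) / (x ^ 2 + y₂ ^ 2) ^ 3)) x :=
  (((hasDerivAt_f hy₁ x).sub (hasDerivAt_f hy₂ x)).const_mul a).add
    (((hasDerivAt_g hy₁ x).add (hasDerivAt_g hy₂ x)).const_mul b)

/-- `∂ₓₓ ω` (the derivative of `∂ₓ ω`). [folklore] -/
theorem hasDerivAt_twoPole_xx {y₁ y₂ : ℝ} (hy₁ : 0 < y₁) (hy₂ : 0 < y₂) (a b x : ℝ) :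
    HasDerivAt (fun x : ℝ => a * ((y₁ ^ 2 - x ^ 2) / (x ^ 2 + y₁ ^ 2) ^ 2 - (y₂ ^ 2 - x ^ 2) / (x ^ 2 + y₂ ^ 2) ^ 2)
        + b * (2 * y₁ * (y₁ ^ 2 - 3 * x ^ 2) / (x ^ 2 + y₁ ^ 2) ^ 3
          + 2 * y₂ * (y₂ ^ 2 - 3 * x ^ 2) / (x ^ 2 + y₂ ^ 2) ^ 3))
      (a * (2 * x * (x ^ 2 - 3 * y₁ ^ 2) / (x ^ 2 + y₁ ^ 2) ^ 3 - 2 * x * (x ^ 2 - 3 * y₂ ^ 2) / (x ^ 2 + y₂ ^ 2) ^ 3)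
        + b * (24 * y₁ * x * (x ^ 2 - y₁ ^ 2) / (x ^ 2 + y₁ ^ 2) ^ 4
          + 24 * y₂ * x * (x ^ 2 - y₂ ^ 2) / (x ^ 2 + y₂ ^ 2) ^ 4)) x :=
  (((hasDerivAt_fx hy₁ x).sub (hasDerivAt_fx hy₂ x)).const_mul a).add
    (((hasDerivAt_gx hy₁ x).add (hasDerivAt_gx hy₂ x)).const_mul b)

/-! ### The exact residual identity of the two-pole ansatz -/

/-- **Residual identity (pure algebra).** With pole depths `y` and `y + s` (`s ≠ 0`), amplitude `a = −24kν/s`,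
`b = −12ν`, depth velocities `ẏ₁ = −10kν/s`, `ẏ₂ = +10kν/s` and `ȧ = 480k²ν²/s³`, the chain-rule time derivative
`ω_t = ȧ(f(y) − f(y+s)) + a(∂_L f(y)·ẏ₁ − ∂_L f(y+s)·ẏ₂) + b(∂_L g(y)·ẏ₁ + ∂_L g(y+s)·ẏ₂)` of the two-pole profile
`ω = a(f(y) − f(y+s)) + b(g(y) + g(y+s))` satisfies, with `Hω` the closed form of `hilbertTransform_twoPole` and `ω_xx` that of
`hasDerivAt_twoPole_xx`,
`ω_t − ω·Hω − ν·ω_xx = (k² − 6k + 3) · (−96ν² x (s + 2y)(x² − y² − sy)) / ((x²+y²)²(x²+(y+s)²)²)`.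
So the viscous CLM holds identically exactly when `k² − 6k + 3 = 0`, i.e. `k = 3 ± √6` (`K_± = 24k` of ALSS).
[cite: AmbroseLushnikovSiegelSilantyev2024, §5.1 (pole-matching equations; corrected `K_± = 24(3 ± √6)`)] -/
theorem residual_identity (ν k s y x : ℝ) (hs : s ≠ 0) (hy : x ^ 2 + y ^ 2 ≠ 0) (hys : x ^ 2 + (y + s) ^ 2 ≠ 0) :
    (480 * k ^ 2 * ν ^ 2 / s ^ 3 * (x / (x ^ 2 + y ^ 2) - x / (x ^ 2 + (y + s) ^ 2))
      + (-24 * k * ν / s) * (-(2 * y * x / (x ^ 2 + y ^ 2) ^ 2) * (-10 * k * ν / s)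
          - -(2 * (y + s) * x / (x ^ 2 + (y + s) ^ 2) ^ 2) * (10 * k * ν / s))
      + (-12 * ν) * (2 * x * (x ^ 2 - 3 * y ^ 2) / (x ^ 2 + y ^ 2) ^ 3 * (-10 * k * ν / s)
          + 2 * x * (x ^ 2 - 3 * (y + s) ^ 2) / (x ^ 2 + (y + s) ^ 2) ^ 3 * (10 * k * ν / s)))
    - ((-24 * k * ν / s) * (x / (x ^ 2 + y ^ 2) - x / (x ^ 2 + (y + s) ^ 2))
        + (-12 * ν) * (2 * y * x / (x ^ 2 + y ^ 2) ^ 2 + 2 * (y + s) * x / (x ^ 2 + (y + s) ^ 2) ^ 2))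
      * (-((-24 * k * ν / s) * (y / (x ^ 2 + y ^ 2) - (y + s) / (x ^ 2 + (y + s) ^ 2)))
        - (-12 * ν) * ((y ^ 2 - x ^ 2) / (x ^ 2 + y ^ 2) ^ 2 + ((y + s) ^ 2 - x ^ 2) / (x ^ 2 + (y + s) ^ 2) ^ 2))
    - ν * ((-24 * k * ν / s) * (2 * x * (x ^ 2 - 3 * y ^ 2) / (x ^ 2 + y ^ 2) ^ 3
          - 2 * x * (x ^ 2 - 3 * (y + s) ^ 2) / (x ^ 2 + (y + s) ^ 2) ^ 3)
        + (-12 * ν) * (24 * y * x * (x ^ 2 - y ^ 2) / (x ^ 2 + y ^ 2) ^ 4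
          + 24 * (y + s) * x * (x ^ 2 - (y + s) ^ 2) / (x ^ 2 + (y + s) ^ 2) ^ 4))
    = (k ^ 2 - 6 * k + 3)
      * (-96 * ν ^ 2 * x * (s + 2 * y) * (x ^ 2 - y ^ 2 - s * y) / ((x ^ 2 + y ^ 2) ^ 2 * (x ^ 2 + (y + s) ^ 2) ^ 2)) := by
  field_simp
  ring

end SheetNSLineSchochetTwoPole
end Summit.NavierStokesRegularity.OSWSelfSimilar

end
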